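import Literature.AlgebraicGeometry.Frobenioids.ArchimedeanStandardTypeProofs
import Literature.AlgebraicGeometry.Frobenioids.ArchimedeanFrobeniusCompact
import HarnessLib

/-!
# Frobenioids II, Theorem 3.6 (ii): "`A` is of standard type" — modulo Proposition 3.5 (ii) only
# (abc-iut cell, layer L1, node `FrdII:Thm3.6(ii)`, L1-lead row M16 piece 3; proof-only)

Mochizuki, *The geometry of Frobenioids II: poly-Frobenioids*, Kyushu J. Math. **62** (2008)
401–460, §3, Theorem 3.6 (ii) p. 37 ll. 3–5, proof p. 38 ll. 32–40 [cite: MochizukiFrdII2008, Thm 3.6 (ii) p.37]: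
"If, moreover, `D` is of FSMFF- and RC-iso-subanchor type, then `A` is of standard … type."

The composition of `ArchFrd.A.isOfStandardType_of` (`ArchimedeanStandardTypeProofs.lean`: (a)
Frobenius-isotropic, (c) Frobenius-normalized, (e) non-dilating PROVED; (a) quasi-isotropic = Prop. 3.5
(ii) BY NAME; (b) one isotropic Frobenius-compact object as input) with
`ArchFrd.A.exists_isotropic_isFrobeniusCompact` (`ArchimedeanFrobeniusCompact.lean`: the complex
isotropic objects of `A` are Frobenius-compact, and a base of RC-iso-subanchor type with an object has a
complex object): over a base `D` of FSMFF- and RC-iso-subanchor type HAVING AN OBJECT (print: "`D`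
connected", Ex. 3.3 (i) p. 27 — the typed schema `Thm36ii_standard_notRationallyStandard` does not bind
it, and at `D = ∅` its standard-type conjunct fails: `A = ∅` is then of group-like type with no
Frobenius-compact object), the angular Frobenioid `A` is of standard type ([FrdI] Def. 3.1 (i)) AS SOON
AS Prop. 3.5 (ii) holds for `A` (`ArchFrd.Prop35ii_A π`, node `FrdII:Prop3.5(ii)`, open) — the single
remaining input. Nothing is defined; no statement of the paper is strengthened; no side is taken on
[IUTchIII] Cor. 3.12.
-/

namespace Literature.AlgebraicGeometry.Frobenioids

open CategoryTheory

universe v u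

namespace ArchFrd

variable {D : Type u} [Category.{v} D] (π : D ⥤ D0)

/-- **Thm. 3.6 (ii), "`A` is of standard type", MODULO Prop. 3.5 (ii) only**: over a base `D` of FSMFF-
and RC-iso-subanchor type with an object `d`, if `A` is quasi-isotropic (Prop. 3.5 (ii) for `A`, input
BY NAME) then the angular Frobenioid `A` is of standard type ([FrdI] Def. 3.1 (i), through the adapter
`PreFrobenioidData.ofFunctor`). [cite: MochizukiFrdII2008, Thm 3.6 (ii) p.37] -/
theorem A.isOfStandardType_of_prop35ii (hD : IsOfFSMFFType D)
    (hrc : RC.IsOfRCIsoSubanchorType (baseRC π)) (d : D) (h35 : Prop35ii_A π) :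
    (PreFrobenioidData.ofFunctor (zeroMonoid D : Dᵒᵖ ⥤ CommMonCat.{0}) (A.toElem π)).IsOfStandardType :=
  A.isOfStandardType_of π hD hrc h35 (A.exists_isotropic_isFrobeniusCompact π hrc d)

/-- The same over a CONNECTED base (the standing hypothesis of Ex. 3.3 (i), p. 27, which supplies the
object). [cite: MochizukiFrdII2008, Thm 3.6 (ii) p.37] -/
theorem A.isOfStandardType_of_prop35ii_of_isGraphConnected (hconn : IsGraphConnected D)
    (hD : IsOfFSMFFType D) (hrc : RC.IsOfRCIsoSubanchorType (baseRC π)) (h35 : Prop35ii_A π) :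
    (PreFrobenioidData.ofFunctor (zeroMonoid D : Dᵒᵖ ⥤ CommMonCat.{0}) (A.toElem π)).IsOfStandardType := by
  obtain ⟨d⟩ := hconn.nonempty
  exact A.isOfStandardType_of_prop35ii π hD hrc d h35

/-- **Thm. 3.6 (i), the "standard type" conjunct of "`C` (`= C^ℤ`) is of rationally standard type",
MODULO Prop. 3.5 (ii) for `C` only**, over a connected base of FSMFF- and RC-iso-subanchor type (an
object of `D` carries the real unit of `C₀` over it, which makes clause (b) vacuous: `C` is not of
group-like type). [cite: MochizukiFrdII2008, Thm 3.6 (i) p.36] -/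
theorem C.isOfStandardType_of_prop35ii_of_isGraphConnected (hconn : IsGraphConnected D)
    (hD : IsOfFSMFFType D) (hrc : RC.IsOfRCIsoSubanchorType (baseRC π)) (h35 : Prop35ii_C π) :
    (PreFrobenioidData.ofFunctor (Φ π) (C.toElem π)).IsOfStandardType := by
  obtain ⟨d⟩ := hconn.nonempty
  obtain ⟨Z, hZ⟩ := exists_complex_of_isOfRCIsoSubanchorType π hrc d
  let X0 : C0 := ⟨D0.complex, AngularRegion.isotropicOfTip 1,
    fun _ => AngularRegion.isIsotropic_isotropicOfTip 1⟩
  have hZ' : X0.base = π.obj Z := hZ.symm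
  exact C.isOfStandardType_of π hD hrc h35 ⟨X0, Z, eqToIso hZ'⟩

end ArchFrd

end Literature.AlgebraicGeometry.Frobenioids
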